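import Summits.ABC.IUTFork.Cor312VolumesRealAssembly
import Literature.IUT.LogVolume.RescaledCompletionInvariants
import Literature.IUT.LogVolume.LocalDegreeBridge
import HarnessLib

/-!
# [IUTchIII] Theorem 3.11 (i) (c) at the real instantiation: the DEGREE CLAUSE DISCHARGED — [IUTchIII]
# Prop. 3.9 (iii) "global log-volume = degree" for the verbatim container with probability weights and the
# direct product regions of fractional ideals

Record file (D-0012) of the abc-iut cell (Cor. 3.12 sub-crew, seat abc-iut-c312-1 — the typer of [IUTchIII]
Thm. 3.11 —, gen 5); TAKES NO SIDE on [IUTchIII] Cor. 3.12. This seat's gen-4 file `Thm311RealFull` recorded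
that at the real instantiation the cell's PREMISE OF RECORD `Thm311.FullSituation.Statement` (typed Thm. 3.11)
is EQUIVALENT to its clause (i) (c) `Situation.DegreeClause` — Thm. 3.11 (i) (c) "whose associated "global
degrees" may be computed by means of the log-volumes of (a) [cf. Proposition 3.9, (iii)]" (kurims
`paper:url-4b091feeb646` p. 154), Prop. 3.9 (iii) p. 117 "by adding the log-volumes … [all but finitely many of
which are zero!] at the various `v_ℚ ∈ 𝕍_ℚ`, one obtains a global log-volume … `μ^log_{A,𝕍_ℚ}(𝔍)` is equal to the
degree of the arithmetic line bundle determined by `𝔍` …, relative to a suitable normalization" — for the BINDERS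
`Adm`, `logvol`, `region`. This file DISCHARGES that clause with honest binders:
* `Adm`/`logvol` := the VERBATIM mono-analytic container of Rmk. 3.1.1 (ii)(iii) on the real prime packets
  `F_{v_0} ⊗_{ℚ_p} ⋯ ⊗_{ℚ_p} F_{v_j}` (abc-iut-c312-5 `SummandPieces`/`PadicPresentation`; abc-iut-c312-3 `PacketAdm`,
  `packetLogμ`) with ONE field changed — the summand weight: c312-3's `packetLogμ` is Dupuy–Hilado's
  NORMALISED `log μ̄ = log μ/dim` (`packetLogμ_ppow_smul`: `×p` costs `log p` per summand), with which the weight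
  realising print's normalization "multiplication by `p_{v_ℚ}` affects log-volumes by … `log(p_{v_ℚ})`" (p. 94) is
  the PROBABILITY weight `Pr(v⃗) = Π_a n_{v_a}/[F:ℚ]^{j+1}` (Dupuy–Hilado §3.6; c312-3 `tupleWeights`), whereas
  c312-5's constant `Real.weightDH = 1/[F:ℚ]^{j+1}` — print's third display, which multiplies the UNNORMALISED
  log-measure (abc-iut-L6-t4 `packetWeightTensor_normalized`) — sums to `(|𝕍(F)_p|/[F:ℚ])^{j+1}` (this seat's finding
  F-c312-1-g5-1; kernel certificates in the proof-only sequel `Thm311RealDegreeFull`). All of c312-5's theorems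
  about the container are weight-agnostic and carry over (`generatorsPreserve_summandPiecesPr`);
* `region` := the DIRECT PRODUCT REGION of a fractional ideal `𝔍 = Π_v 𝔭_v^{−c_v}` (Ex. 3.6 (ii)): at `v_ℚ = p` the
  preimage under the comparison `e : 𝓘^ℚ(^{S^±_{j+1}};𝒟^⊢_p) → Π_{v⃗} X_{v⃗}` of `Π_{v⃗} ι_j(ϖ_{v_j}^{−c_{v_j}})·(R_{v⃗})^∼` (integral
  structure of the summand scaled through the LAST tensor factor; `ϖ_v` a norm uniformizer, abc-iut-S7
  `exists_isUniformizer_rescaledCompletion`), at `v_ℚ = ∞` the whole packet (c312-5's trivial archimedean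
  container, Dupuy–Hilado convention);
* objects of `F^⊛_mod,j` := INTEGER divisors `𝕍(F)^non →₀ ℤ` (the NON-realified Frobenioid of Prop. 3.9 (iii);
  c312-5's `GlobalDegrees.ofDivisors` takes `ℝ`-divisors = the realification, for whose irrational coefficients no
  ideal exists), `deg := deĝ(𝔍)/[F:ℚ]` (`FinDivisor.ndeg`; "relative to a suitable normalization").
PROVED: `Real.logvol_idealRegion_inr` (log-volume at `p` = `(1/[F:ℚ])·Σ_{v|p} c_v·log|κ(v)|`: c312-3's (3.7)
`packetLogμ_iota_smul_normalizedPacket` + `tupleWeights_expect_coord`), `Real.finsum_logvol_idealRegion` (`Σ_{v_ℚ} =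
deĝ(𝔍)/[F:ℚ]`), **`Real.degreesViaLogvol_ofIdeals`**: this seat's typed clause `DegreesViaLogvol` HOLDS for every
line carrying the container (the `Situation`-level assembly is the proof-only sequel) — Prop. 3.9 (iii)'s degree
sentence for the REAL tensor-packet containers of a number field (companion of abc-iut-L6-d3 `prop39iii_degree_dh`
for the abstract Dupuy–Hilado model). Sources read on the page (this seat's render of `paper:url-4b091feeb646`):
p. 94 (Rmk. 3.1.1 (ii)), p. 95 l. 26–31, p. 117, p. 154. [claim: Mochizuki2012, status: disputed] for the quoted
sentences; [cite: DupuyHilado2025, §3.4, §3.6, Def. 3.6.1, §3.7]. HONEST FRAMING: a measurement of the typing at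
the real carriers; no edit to c312-5's / c312-3's files; no judgement on Cor. 3.12. typed ≠ proved.
-/

noncomputable section

open Set Function NumberField IsDedekindDomain
open scoped Pointwise

namespace Summit.ABC.IUTFork.Thm311

open Cor312Vol Literature.IUT.LogThetaLattice Literature.IUT.LogVolume Literature.NumberTheory.NumberFields

/-! ## 0. `F^⊛_mod,j` by INTEGER divisors with the normalised degree -/

namespace GlobalDegrees

variable {T : ThetaIndex}

/-- **`Thm311.GlobalDegrees` BUILT FROM FRACTIONAL IDEALS** at label `j ∈ 𝔽_l^⋇` ([IUTchIII] Thm. 3.11 (i) (c);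
Ex. 3.6 (ii) "collections `𝔍 = {𝔍_v}_{v∈𝕍}` of local fractional ideals … almost all trivial"; Prop. 3.9 (iii)):
objects of the NON-realified `F^⊛_MOD,j ⥲ F^⊛_mod,j` := integer divisors on the finite places (archimedean
components and linear equivalence elided, as in c312-5's `ofDivisors`), one carrier, `deg 𝔍 := deĝ(𝔍)/[M:ℚ]` the
normalised Arakelov degree of the image in the realification (c312-3 `FinDivisor.ndeg`; "relative to a suitable
normalization", p. 117), the region determined by `𝔍` as the argument `region`. [claim: Mochizuki2012, status: disputed] -/
def ofIdeals (L : LogShells T) (M : Type) [Field M] [NumberField M] (j : T.LabelStar)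
    (region : (HeightOneSpectrum (𝓞 M) →₀ ℤ) → ∀ vQ : T.VQ, Set (L.Packet j.1 vQ)) : GlobalDegrees L j where
  ObjMOD := HeightOneSpectrum (𝓞 M) →₀ ℤ
  Objmod := HeightOneSpectrum (𝓞 M) →₀ ℤ
  natIso := Equiv.refl _
  deg J := FinDivisor.ndeg M (Finsupp.mapRange (Int.cast : ℤ → ℝ) Int.cast_zero J)
  region := region

/-- The degree of `ofIdeals`, unfolded: `deg 𝔍 = (Σ_v c_v·log|κ(v)|)/[M:ℚ]`. [cite: DupuyHilado2025, §2.5.4] -/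
theorem ofIdeals_deg (L : LogShells T) (M : Type) [Field M] [NumberField M] (j : T.LabelStar)
    (region : (HeightOneSpectrum (𝓞 M) →₀ ℤ) → ∀ vQ : T.VQ, Set (L.Packet j.1 vQ))
    (J : HeightOneSpectrum (𝓞 M) →₀ ℤ) :
    (ofIdeals L M j region).deg J = (J.sum fun v c => (c : ℝ) * logNorm M v) / Module.finrank ℚ M := by
  show FinDivisor.ndeg M (Finsupp.mapRange (Int.cast : ℤ → ℝ) Int.cast_zero J) = _
  rw [FinDivisor.ndeg_apply, FinDivisor.deg_apply, Finsupp.sum_mapRange_index fun v => zero_mul _]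

end GlobalDegrees

namespace Real

variable {F : Type} [Field F] [NumberField F] (X : PilotData F) (p : ℕ) [hp : Fact p.Prime]

/-! ## 1. The probability weights `Pr(v⃗) = Π_a n_{v_a}/[F:ℚ]^{j+1}` -/

/-- **The probability weight of the summand `v⃗`** of the `(j+1)`-packet over `p`: `Pr(v⃗) = Π_a n_{v_a}/[F:ℚ]`
(Dupuy–Hilado §3.6 "`Pr(v) = [F_{0,v}:ℚ_p]/[F₀:ℚ]`", independent power; c312-3 `weight`/`tupleWeights`) — the weight
that, multiplying the NORMALISED `log μ̄`, realises [IUTchIII] Rmk. 3.1.1 (ii)'s normalization (p. 94).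
[cite: DupuyHilado2025, §3.6] -/
def weightPr (j : (thetaIndex X).Label)
    (e : (thetaIndex X).Caps j → (thetaIndex X).Fibre (.inr (ratPrime p))) : ℝ :=
  ∏ a, weight F (placeOf X p (e a))

/-- `Pr(v⃗) ≥ 0`. [cite: DupuyHilado2025, §3.6] -/
theorem weightPr_nonneg (j : (thetaIndex X).Label)
    (e : (thetaIndex X).Caps j → (thetaIndex X).Fibre (.inr (ratPrime p))) : 0 ≤ weightPr X p j e :=
  Finset.prod_nonneg fun _ _ => weight_nonneg F _

/-- `Pr(v⃗∘σ) = Pr(v⃗)` for a permutation `σ` of the capsule index ((Ind1) symmetry). [cite: DupuyHilado2025, §3.6] -/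
theorem weightPr_perm (j : (thetaIndex X).Label) (σ : Equiv.Perm ((thetaIndex X).Caps j))
    (e : (thetaIndex X).Caps j → (thetaIndex X).Fibre (.inr (ratPrime p))) :
    weightPr X p j (e ∘ σ) = weightPr X p j e :=
  Fintype.prod_equiv σ _ _ fun _ => rfl

/-! ## 2. The verbatim container with probability weights -/

variable (logv : PadicLogs F)

/-- **The `p`-adic presentation of the real Dupuy–Hilado-level signature with PROBABILITY WEIGHTS**: c312-5's
`Real.padicPresentationDH X p logv hlog` (`K_v` = the rescaled completion, `φ_v = id`, `c = (p^*)⁻¹`, strips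
trivial, `Ism` = bicontinuous shell-preserving automorphisms) with the single field `w` replaced by
`Pr(v⃗) = Π_a n_{v_a}/[F:ℚ]^{j+1}` (§1 and the module docstring). [claim: Mochizuki2012, status: disputed] -/
def padicPresentationPr (hlog : LogvAnalyticAt p logv) :
    PadicPresentation (logShellsDH X logv) (.inr (ratPrime p)) p :=
  { padicPresentationDH X p logv hlog with
    w := fun j e => weightPr X p j e
    w_nonneg := fun j e => weightPr_nonneg X p j e
    w_perm := fun j σ e => weightPr_perm X p j σ e }

/-- **(Ind1)/(Ind2) generator facts for the probability-weighted container at `v_ℚ = p`** — c312-5's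
`PadicPresentation.generatorsPreserve_toLocalPieces` (capsule permutations with SYMMETRIC weights, Dupuy–Hilado
(Ind2)-automorphisms), verbatim. [cite: DupuyHilado2025, §4.7, §4.9] -/
theorem generatorsPreservePr (hlog : LogvAnalyticAt p logv) :
    (padicPresentationPr X p logv hlog).toLocalPieces.GeneratorsPreserve :=
  (padicPresentationPr X p logv hlog).generatorsPreserve_toLocalPieces

variable {logv}

/-- **The local pieces at every place**, probability-weighted at the primes, trivial at `∞` (c312-5's
Dupuy–Hilado convention, `LocalPieces.trivial`). [claim: Mochizuki2012, status: disputed] -/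
def localPiecesPr (hlog : LogvAnalytic logv) :
    ∀ vQ : (thetaIndex X).VQ, LocalPieces (logShellsDH X logv) vQ
  | .inl _ => LocalPieces.trivial _ _
  | .inr pp => haveI : Fact (pp : ℕ).Prime := ⟨pp.2⟩; (padicPresentationPr X pp.1 logv (hlog pp)).toLocalPieces

/-- **The verbatim container of the real log-shells over all places, probability-weighted**: the binders `Adm`,
`logvol` of c312-5's `Situation.ofShells` at the Dupuy–Hilado level, CONCRETE, with [IUTchIII] Rmk. 3.1.1 (ii)'s
normalization holding (sequel `Thm311RealDegreeFull`). [claim: Mochizuki2012, status: disputed] -/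
def summandPiecesPr (hlog : LogvAnalytic logv) : SummandPieces (logShellsDH X logv) :=
  SummandPieces.ofLocal (localPiecesPr X hlog)

/-- **The generator hypotheses HOLD for the probability-weighted container** (hence, by c312-5's
`Cor312VolumesSummands`/`…Bridge`, (Ind1)/(Ind2)-invariance of admissibility and log-volume along the whole
indeterminacy subgroup and c312-6's `BridgeHyps.image_adm`/`image_fin` for every line realizing it).
[cite: DupuyHilado2025, §4.7, §4.9] -/
theorem generatorsPreserve_summandPiecesPr (hlog : LogvAnalytic logv) :
    (summandPiecesPr X hlog).GeneratorsPreserve :=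
  SummandPieces.generatorsPreserve_ofLocal _ fun vQ =>
    match vQ with
    | .inl u => LocalPieces.generatorsPreserve_trivial (logShellsDH X logv) (.inl u)
    | .inr pp => by haveI : Fact (pp : ℕ).Prime := ⟨pp.2⟩; exact generatorsPreservePr X pp.1 logv (hlog pp)

/-! ## 3. The direct product region of a fractional ideal and its log-volume -/

/-- A NORM UNIFORMIZER `ϖ_v` of the rescaled completion `F_v` at a place of the fibre over `p` (chosen by
abc-iut-S7's `exists_isUniformizer_rescaledCompletion`: `‖ϖ_v‖ = p^{−1/e(v|p)}`). [cite: NeukirchANT1999, Ch. II Prop. (6.8)] -/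
def unifOf (x : (thetaIndex X).Fibre (.inr (ratPrime p))) : (kOf X p x)ˣ :=
  (exists_isUniformizer_rescaledCompletion F p (placeOf X p x) (natCast_mem_placeOf X p x)).choose

/-- `‖ϖ_v‖ = p^{−1/e(v|p)}`. [cite: NeukirchANT1999, Ch. II Prop. (6.8)] -/
theorem norm_unifOf (x : (thetaIndex X).Fibre (.inr (ratPrime p))) :
    ‖(unifOf X p x : kOf X p x)‖ = (p : ℝ) ^ (-(1 / ((placeOf X p x).asIdeal.ramificationIdx ℤ : ℝ))) :=
  (exists_isUniformizer_rescaledCompletion F p (placeOf X p x) (natCast_mem_placeOf X p x)).choose_spec.2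

/-- `log|κ(v)|/n_v = (log p)/e(v|p)` (`|κ(v)| = p^{f}`, `n_v = e·f`). [cite: NeukirchANT1999, Ch. II Prop. (6.8)] -/
theorem logNorm_div_localDegree (x : (thetaIndex X).Fibre (.inr (ratPrime p))) :
    logNorm F (placeOf X p x) / localDegree F (placeOf X p x) =
      Real.log p / ((placeOf X p x).asIdeal.ramificationIdx ℤ : ℝ) := by
  rw [← localDeg_eq_localDegree, logNorm, absNorm_eq_pow_inertiaDeg F p (placeOf X p x) (natCast_mem_placeOf X p x),
    localDeg]
  have he : ((placeOf X p x).asIdeal.ramificationIdx ℤ : ℝ) ≠ 0 := by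
    exact_mod_cast (Ideal.ramificationIdx_pos _ _).ne'
  have hf : ((placeOf X p x).asIdeal.inertiaDeg ℤ : ℝ) ≠ 0 := by
    exact_mod_cast (Ideal.inertiaDeg_pos _ _).ne'
  push_cast
  rw [Real.log_pow]
  field_simp

/-- **`log ‖ϖ_v^{−c}‖ = c·log|κ(v)|/n_v`** — the (3.4)/(3.7) scalar of the ideal `𝔭_v^{−c}`. [cite: DupuyHilado2025, §3.4] -/
theorem log_norm_unifOf_zpow (x : (thetaIndex X).Fibre (.inr (ratPrime p))) (c : ℤ) :
    Real.log ‖((unifOf X p x ^ (-c) : (kOf X p x)ˣ) : kOf X p x)‖ =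
      c * logNorm F (placeOf X p x) / localDegree F (placeOf X p x) := by
  rw [mul_div_assoc, logNorm_div_localDegree, Units.val_zpow_eq_zpow_val, norm_zpow, norm_unifOf,
    ← Real.rpow_intCast, ← Real.rpow_mul (by positivity), Real.log_rpow (by exact_mod_cast hp.out.pos)]
  push_cast
  ring

section Box

variable (hlog : LogvAnalyticAt p logv)

/-- **The box of the summand `v⃗`** for an integer divisor `𝔍 = Σ c_v[v]`: `ι_j(ϖ_{v_j}^{−c_{v_j}})·(R_{v⃗})^∼ ⊆
F_{v_0} ⊗_{ℚ_p} ⋯ ⊗_{ℚ_p} F_{v_j}` — the integral structure of the summand (c312-3 `normalizedPacket`) multiplied through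
the LAST tensor factor (c312-3 `iota`; Dupuy–Hilado §3.7) by a generator of `𝔭_{v_j}^{−c_{v_j}}`. [cite: DupuyHilado2025, §3.7] -/
def idealBox (J : HeightOneSpectrum (𝓞 F) →₀ ℤ) {j : (thetaIndex X).Label}
    (e : (thetaIndex X).Caps j → (thetaIndex X).Fibre (.inr (ratPrime p))) :
    Set ((padicPresentationPr X p logv hlog).X e) :=
  iota p ((padicPresentationPr X p logv hlog).kk e) ((thetaIndex X).selfIndex j)
      ((unifOf X p (e ((thetaIndex X).selfIndex j)) ^ (-J (placeOf X p (e ((thetaIndex X).selfIndex j)))) :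
        (kOf X p _)ˣ) : kOf X p _) •
    (normalizedPacket p ((padicPresentationPr X p logv hlog).kk e) :
      Set ((padicPresentationPr X p logv hlog).X e))

/-- Every box is admissible (positive finite Haar measure: a nondegenerate translate of `(R_{v⃗})^∼`, c312-3's
`packetAdm_iota_smul`). [cite: DupuyHilado2025, §3.7] -/
theorem idealBox_adm (J : HeightOneSpectrum (𝓞 F) →₀ ℤ) {j : (thetaIndex X).Label}
    (e : (thetaIndex X).Caps j → (thetaIndex X).Fibre (.inr (ratPrime p))) :
    PacketAdm p ((padicPresentationPr X p logv hlog).kk e) (idealBox X p hlog J e) :=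
  packetAdm_iota_smul p ((padicPresentationPr X p logv hlog).kk e) ((thetaIndex X).selfIndex j)
    (Units.ne_zero _) (packetAdm_normalizedPacket p _)

/-- **`log μ̄_{v⃗}(box) = c_{v_j}·log|κ(v_j)|/n_{v_j}`** (c312-3's (3.7) `packetLogμ_iota_smul_normalizedPacket`:
`log μ̄(ι_i(a)·(R_I)^∼) = log ‖a‖`). [cite: DupuyHilado2025, §3.4, §3.7] -/
theorem packetLogμ_idealBox (J : HeightOneSpectrum (𝓞 F) →₀ ℤ) {j : (thetaIndex X).Label}
    (e : (thetaIndex X).Caps j → (thetaIndex X).Fibre (.inr (ratPrime p))) :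
    packetLogμ p ((padicPresentationPr X p logv hlog).kk e) (idealBox X p hlog J e) =
      J (placeOf X p (e ((thetaIndex X).selfIndex j))) * logNorm F (placeOf X p (e ((thetaIndex X).selfIndex j))) /
        localDegree F (placeOf X p (e ((thetaIndex X).selfIndex j))) := by
  rw [idealBox, packetLogμ_iota_smul_normalizedPacket p ((padicPresentationPr X p logv hlog).kk e)
    ((thetaIndex X).selfIndex j) (Units.ne_zero _)]
  exact log_norm_unifOf_zpow X p _ _

end Box

section Region

variable (hlog : LogvAnalytic logv)

/-- **The region of `Π_{v_ℚ} 𝓘^ℚ(^{S^±_{j+1}};𝒟^⊢_{v_ℚ})` determined by the fractional ideal `𝔍`** ([IUTchIII] Prop. 3.9 (iii)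
"the elements of `𝕄(…)` determined by objects `𝔍`"; Rmk. 3.1.1 (iii) direct product regions): at every prime the
preimage under the comparison of the product of the boxes, at `∞` the whole packet (trivial archimedean
container). [claim: Mochizuki2012, status: disputed] -/
def idealRegion (j : (thetaIndex X).Label) (J : HeightOneSpectrum (𝓞 F) →₀ ℤ) :
    ∀ vQ : (thetaIndex X).VQ, Set ((logShellsDH X logv).Packet j vQ)
  | .inl _ => Set.univ
  | .inr pp => haveI : Fact (pp : ℕ).Prime := ⟨pp.2⟩
      (padicPresentationPr X pp.1 logv (hlog pp)).comparison j ⁻¹' Set.pi univ fun e =>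
        idealBox X pp.1 (hlog pp) J e

/-- **The ideal region is ADMISSIBLE everywhere** (at `∞`: nonempty, trivial container; at `p`: a product of boxes of
positive finite measure). [folklore] -/
theorem adm_idealRegion (j : (thetaIndex X).Label) (J : HeightOneSpectrum (𝓞 F) →₀ ℤ)
    (vQ : (thetaIndex X).VQ) : (summandPiecesPr X hlog).Adm j vQ (idealRegion X hlog j J vQ) := by
  rcases vQ with u | pp
  · exact (LocalPieces.adm_trivial_iff (logShellsDH X logv) (.inl u) j _).2 ⟨0, trivial⟩
  · haveI : Fact (pp : ℕ).Prime := ⟨pp.2⟩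
    exact (summandPiecesPr X hlog).adm_preimage_pi j (.inr (ratPrime pp.1)) fun e =>
      idealBox_adm X pp.1 (hlog (ratPrime pp.1)) J e

/-- Its log-volume at `∞` is `0`. [folklore] -/
theorem logvol_idealRegion_inl (j : (thetaIndex X).Label) (J : HeightOneSpectrum (𝓞 F) →₀ ℤ) (u : Unit) :
    (summandPiecesPr X hlog).logvol j (.inl u) (idealRegion X hlog j J (.inl u)) = 0 := by
  refine Finset.sum_eq_zero fun e _ => ?_
  show (0 : ℝ) * 0 = 0
  simp

/-- **Its log-volume at `p` is `(1/[F:ℚ])·Σ_{v|p} c_v·log|κ(v)|`** (`Σ_{v⃗} Pr(v⃗)·c_{v_j}·log|κ(v_j)|/n_{v_j}`; `𝔼` over the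
last coordinate `= 𝔼` over `𝕍(F)_p`, c312-3 `tupleWeights_expect_coord`; `Pr(v)/n_v = 1/[F:ℚ]`: Dupuy–Hilado's proof
of Thm. 3.10.1 (iii) at one prime). [cite: DupuyHilado2025, Thm. 3.10.1] -/
theorem logvol_idealRegion_inr (j : (thetaIndex X).Label) (J : HeightOneSpectrum (𝓞 F) →₀ ℤ) :
    (summandPiecesPr X hlog).logvol j (.inr (ratPrime p)) (idealRegion X hlog j J (.inr (ratPrime p))) =
      (∑ v ∈ placesOver F p, (J v : ℝ) * logNorm F v) / Module.finrank ℚ F := by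
  show (summandPiecesPr X hlog).logvol j (.inr (ratPrime p))
      ((summandPiecesPr X hlog).e j (.inr (ratPrime p)) ⁻¹' Set.pi univ fun e =>
        idealBox X p (hlog (ratPrime p)) J e) = _
  rw [(summandPiecesPr X hlog).logvol_preimage_pi j (.inr (ratPrime p))
    fun e => idealBox_adm X p (hlog (ratPrime p)) J e]
  have hμ : ∀ e, (summandPiecesPr X hlog).logμ j (.inr (ratPrime p)) e (idealBox X p (hlog (ratPrime p)) J e) =
      J (placeOf X p (e ((thetaIndex X).selfIndex j))) * logNorm F (placeOf X p (e ((thetaIndex X).selfIndex j))) /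
        localDegree F (placeOf X p (e ((thetaIndex X).selfIndex j))) := fun e =>
    packetLogμ_idealBox X p (hlog (ratPrime p)) J e
  simp only [hμ]
  refine Eq.trans (b := ∑ e' : Fin ((j : ℕ) + 1) → placesOver F p,
    (J (e' (Fin.last _)).1 : ℝ) * logNorm F (e' (Fin.last _)).1 / localDegree F (e' (Fin.last _)).1 *
      (tupleWeights F p (j : ℕ)).pr e') ?_ ?_
  · exact Finset.sum_equiv
      (Equiv.arrowCongr (Equiv.refl ((thetaIndex X).Caps j)) (fibreEquivPlacesOver X (ratPrime p)))
      (fun _ => ⟨fun _ => Finset.mem_univ _, fun _ => Finset.mem_univ _⟩)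
      (fun e _ => by rw [mul_comm]; rfl)
  refine (tupleWeights_expect_coord F p (j : ℕ) (Fin.last _)
    (fun v : placesOver F p => (J v.1 : ℝ) * logNorm F v.1 / localDegree F v.1)).trans ?_
  have h2 := expect_neg_deg_div_localDegree' F p fun v => -(J v.1 : ℝ)
  simp only [neg_mul, neg_neg] at h2
  rw [h2, FinDivisor.ndeg_apply, map_sum, ← neg_div, ← Finset.sum_neg_distrib]
  congr 1
  rw [← Finset.sum_coe_sort (placesOver F p)]
  refine Finset.sum_congr rfl fun v _ => ?_
  rw [FinDivisor.deg_of]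
  ring

/-! ## 4. The degree clause -/

omit hp in
/-- The rational prime under a finite place, in the index `𝕍_ℚ` of the instantiated signature. [folklore] -/
theorem over_inr_eq (v : HeightOneSpectrum (𝓞 F)) :
    (thetaIndex X).over (.inr v : Place F) = .inr ⟨residueChar F v, residueChar_prime F v⟩ := rfl

open scoped Classical in
/-- **The local log-volumes of an ideal region vanish off the primes under the support of `𝔍`** ("all but
finitely many of which are zero!", Prop. 3.9 (iii)). [claim: Mochizuki2012, status: disputed] -/
theorem support_logvol_idealRegion_subset (j : (thetaIndex X).Label) (J : HeightOneSpectrum (𝓞 F) →₀ ℤ) :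
    (Function.support fun vQ : (thetaIndex X).VQ =>
        (summandPiecesPr X hlog).logvol j vQ (idealRegion X hlog j J vQ)) ⊆
      ↑(J.support.image fun v => (thetaIndex X).over (.inr v : Place F)) := by
  intro vQ hvQ
  rw [Function.mem_support] at hvQ
  rcases vQ with u | pp
  · exact absurd (logvol_idealRegion_inl X hlog j J u) hvQ
  · haveI : Fact (pp : ℕ).Prime := ⟨pp.2⟩
    have h := logvol_idealRegion_inr X pp.1 hlog j J
    rw [show ratPrime pp.1 = pp from rfl] at h
    rw [h] at hvQ
    obtain ⟨v, hv, hJv⟩ : ∃ v ∈ placesOver F pp.1, (J v : ℝ) * logNorm F v ≠ 0 := by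
      by_contra hcon
      simp only [not_exists, not_and, not_not] at hcon
      exact hvQ (by rw [Finset.sum_eq_zero hcon, zero_div])
    rw [Finset.coe_image, Set.mem_image]
    refine ⟨v, Finset.mem_coe.mpr (Finsupp.mem_support_iff.mpr fun h0 => hJv (by simp [h0])), ?_⟩
    rw [over_inr_eq]
    exact congrArg Sum.inr (Subtype.ext ((mem_placesOver_iff_residueChar v).mp hv))

/-- Hence finitely many `v_ℚ` carry a non-zero log-volume. [claim: Mochizuki2012, status: disputed] -/
theorem finite_logvol_idealRegion (j : (thetaIndex X).Label) (J : HeightOneSpectrum (𝓞 F) →₀ ℤ) :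
    {vQ : (thetaIndex X).VQ | (summandPiecesPr X hlog).logvol j vQ (idealRegion X hlog j J vQ) ≠ 0}.Finite := by
  classical
  exact (Finset.finite_toSet _).subset (support_logvol_idealRegion_subset X hlog j J)

/-- **THE GLOBAL LOG-VOLUME OF THE IDEAL REGION IS THE NORMALISED DEGREE** `Σ_{v_ℚ} μ^log_{j,v_ℚ}(region(𝔍)) =
deĝ(𝔍)/[F:ℚ]` — [IUTchIII] Prop. 3.9 (iii) "the global log-volume `μ^log_{A,𝕍_ℚ}(𝔍)` is equal to the degree of the
arithmetic line bundle determined by `𝔍` … relative to a suitable normalization", for the REAL tensor-packet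
containers of `F`. [claim: Mochizuki2012, status: disputed] -/
theorem finsum_logvol_idealRegion (j : (thetaIndex X).Label) (J : HeightOneSpectrum (𝓞 F) →₀ ℤ) :
    ∑ᶠ vQ : (thetaIndex X).VQ, (summandPiecesPr X hlog).logvol j vQ (idealRegion X hlog j J vQ) =
      (J.sum fun v c => (c : ℝ) * logNorm F v) / Module.finrank ℚ F := by
  classical
  rw [finsum_eq_sum_of_support_subset _ (support_logvol_idealRegion_subset X hlog j J)]
  -- the sum over the primes under the support, prime by prime
  have hterm : ∀ vQ ∈ J.support.image fun v => (thetaIndex X).over (.inr v : Place F),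
      (summandPiecesPr X hlog).logvol j vQ (idealRegion X hlog j J vQ) =
        (∑ v ∈ J.support with (thetaIndex X).over (.inr v : Place F) = vQ, (J v : ℝ) * logNorm F v) /
          Module.finrank ℚ F := by
    intro vQ hvQ
    obtain ⟨v₀, -, rfl⟩ := Finset.mem_image.mp hvQ
    haveI : Fact (residueChar F v₀).Prime := ⟨residueChar_prime F v₀⟩
    have h := logvol_idealRegion_inr X (residueChar F v₀) hlog j J
    rw [show (Sum.inr (ratPrime (residueChar F v₀)) : (thetaIndex X).VQ) =
      (thetaIndex X).over (.inr v₀ : Place F) from rfl] at h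
    rw [h]
    congr 1
    symm
    apply Finset.sum_subset
    · intro v hv
      rw [Finset.mem_filter] at hv
      have h1 := hv.2
      rw [over_inr_eq, over_inr_eq] at h1
      exact (mem_placesOver_iff_residueChar v).mpr (congrArg Subtype.val (Sum.inr.inj h1))
    · intro v hv hv'
      rw [Finset.mem_filter, not_and'] at hv'
      have hres : (thetaIndex X).over (.inr v : Place F) = (thetaIndex X).over (.inr v₀ : Place F) := by
        rw [over_inr_eq, over_inr_eq]
        exact congrArg Sum.inr (Subtype.ext ((mem_placesOver_iff_residueChar v).mp hv))
      have hJ : J v = 0 := Finsupp.notMem_support_iff.mp (hv' hres)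
      simp [hJ]
  rw [Finset.sum_congr rfl hterm, ← Finset.sum_div, Finset.sum_fiberwise_of_maps_to
    (g := fun v => (thetaIndex X).over (.inr v : Place F))
    (fun v hv => Finset.mem_image_of_mem (fun v => (thetaIndex X).over (.inr v : Place F)) hv), Finsupp.sum]

/-- **THE DEGREE CLAUSE (Thm. 3.11 (i) (c)) HOLDS for every vertical line whose data (a) carry the
probability-weighted verbatim container**, with (c)'s global Frobenioids by fractional ideals and their direct
product regions: this seat's typed `Thm311.DegreesViaLogvol` ([IUTchIII] Thm. 3.11 (i) (c) p. 154 + Prop. 3.9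
(iii) p. 117), DISCHARGED at the real carriers. [claim: Mochizuki2012, status: disputed] -/
theorem degreesViaLogvol_ofIdeals {D : MRData (logShellsDH X logv)} (hD : (summandPiecesPr X hlog).Realizes D) :
    DegreesViaLogvol D fun j => GlobalDegrees.ofIdeals (logShellsDH X logv) F j (idealRegion X hlog j.1) := by
  intro j J
  refine ⟨fun vQ => (hD.adm_iff _ _ _).2 (adm_idealRegion X hlog j.1 J vQ), ?_, ?_⟩
  · show {vQ | D.logvol j.1 vQ (idealRegion X hlog j.1 J vQ) ≠ 0}.Finite
    simp_rw [hD.logvol_eq]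
    exact finite_logvol_idealRegion X hlog j.1 J
  · show (GlobalDegrees.ofIdeals (logShellsDH X logv) F j (idealRegion X hlog j.1)).deg J =
      ∑ᶠ vQ, D.logvol j.1 vQ (idealRegion X hlog j.1 J vQ)
    simp_rw [hD.logvol_eq]
    rw [finsum_logvol_idealRegion, GlobalDegrees.ofIdeals_deg]

end Region

end Real

end Summit.ABC.IUTFork.Thm311

end
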